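/-
Copyright (c) 2026. All rights reserved.
Released under Apache 2.0 license as described in the file LICENSE.
Authors: abc-iut cell, seat abc-iut-w5-d024 (gen 5).
-/
import Literature.GroupTheory.Solvable.SchurZassenhausConjugacy
import Mathlib.Topology.Algebra.ClopenNhdofOne
import Mathlib.Topology.Algebra.OpenSubgroup
import Mathlib.Topology.Algebra.Group.ClosedSubgroup
import Mathlib.GroupTheory.PGroup
import Mathlib.GroupTheory.Nilpotent

/-!
# The profinite Schur–Zassenhaus theorem: conjugacy of closed complements (`p`-primary case)

Let `G` be a profinite group and `P ⊴ G` a closed normal subgroup which is pro-`p` with pro-`p′`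
quotient, levelwise: in every finite continuous quotient `G ⧸ V` (`V` open normal) the image `P̄_V` of
`P` is a `p`-group of index prime to `p`.  Then

* `isComplement'_map_mk'_of_isComplement'` — every CLOSED complement `C` of `P` (`P ∩ C = 1`,
  `P C = G`) maps to a complement of `P̄_V` in each `G ⧸ V` (its image `C̄_V ≅ C/(C ∩ V)` has order
  `[G : P(C ∩ V)]`, the index of an open subgroup containing `P`, hence prime to `p`);
* **`exists_conj_eq_of_closed_isComplement'`** — any two closed complements of `P` are CONJUGATE: the
  images are conjugate in every `G ⧸ V` by the finite Schur–Zassenhaus theorem (tree: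
  `Literature.GroupTheory.Solvable.exists_conj_eq_of_isComplement'_of_isSolvable`, the solvable-kernel
  case — a `p`-group is nilpotent), and the closed nonempty sets
  `{x | x C x⁻¹ ⊆ C′V}` are directed in `V`, so compactness produces `x` with `x C x⁻¹ ⊆ ⋂_V C′V = C′`,
  and a complement contained in a complement is equal to it.

Together with the existence half (`Literature.GroupTheory.exists_closed_isComplement'_of_coprime`,
file `ProfiniteSchurZassenhaus.lean`) this is the profinite Schur–Zassenhaus theorem
[cite: RibesZalesskii2010, Thm 2.3.15] in the `p`-primary case; motivation in the abc-iut cell: the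
Frattini argument `G = P · N_G(C)` and the splitting of the wild-inertia sequence of a `p`-adic field
(GAP row G-L3d2g2-1 / fact F-1977 at `Γ_F`).  Classical; Mathlib + the tree's finite conjugacy
theorem; no definitions; nothing here concerns [IUTchIII] Cor. 3.12.
-/

open scoped Pointwise

namespace Literature.GroupTheory

open Subgroup

/-! ### Index transfer along a complement -/

section Algebra

variable {G : Type*} [Group G]

/-- If `P ⊴ G` has complement `C` and `D ≤ C`, then `C ∩ P D = D` (Dedekind).
[cite: RibesZalesskii2010, Thm 2.3.15] -/
theorem inf_sup_eq_of_isComplement' (P C : Subgroup G) [P.Normal] (hPC : IsComplement' P C)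
    {D : Subgroup G} (hDC : D ≤ C) : C ⊓ (P ⊔ D) = D := by
  refine le_antisymm ?_ (le_inf hDC le_sup_right)
  rintro x ⟨hxC, hxPD⟩
  have hx : x ∈ ((P ⊔ D : Subgroup G) : Set G) := hxPD
  rw [Subgroup.normal_mul] at hx
  obtain ⟨q, hq, d, hd, rfl⟩ := Set.mem_mul.mp hx
  have hqC : q ∈ C := by
    have hdC : d ∈ C := hDC hd
    have : q * d * d⁻¹ ∈ C := C.mul_mem hxC (C.inv_mem hdC)
    rwa [mul_inv_cancel_right] at this
  have hq1 : q = 1 := by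
    have hdis := hPC.disjoint
    rw [disjoint_iff] at hdis
    have : q ∈ P ⊓ C := ⟨hq, hqC⟩
    rw [hdis] at this
    exact this
  rw [hq1, one_mul]
  exact hd

/-- **Index transfer along a complement.** If `P ⊴ G` has complement `C` and `D ≤ C`, then
`[C : D] = [G : P D]`: the map `c D ↦ c (P D)` is a bijection `C/D → G/PD` (injective by
`C ∩ P D = D`, surjective since `G = P C` and `P` is normal). [cite: RibesZalesskii2010, Thm 2.3.15] -/
theorem relIndex_eq_index_sup_of_isComplement' (P C : Subgroup G) [P.Normal]
    (hPC : IsComplement' P C) {D : Subgroup G} (hDC : D ≤ C) :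
    D.relIndex C = (P ⊔ D).index := by
  classical
  rw [Subgroup.relIndex, Subgroup.index_eq_card, Subgroup.index_eq_card]
  -- the comparison map `C / D → G / P D`
  let φ : C ⧸ D.subgroupOf C → G ⧸ (P ⊔ D) :=
    Quotient.map' (fun c : C => (c : G)) (by
      intro a b hab
      rw [QuotientGroup.leftRel_apply] at hab ⊢
      exact mem_sup_right (by simpa [Subgroup.mem_subgroupOf] using hab))
  refine Nat.card_eq_of_bijective φ ⟨?_, ?_⟩
  · rintro ⟨a⟩ ⟨b⟩ hab
    change Quotient.mk'' _ = Quotient.mk'' _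
    change φ (Quotient.mk'' a) = φ (Quotient.mk'' b) at hab
    have hab' : (QuotientGroup.mk (a : G) : G ⧸ (P ⊔ D)) = QuotientGroup.mk (b : G) := hab
    rw [QuotientGroup.eq] at hab'
    apply Quotient.sound'
    rw [QuotientGroup.leftRel_apply, Subgroup.mem_subgroupOf]
    have hmem : ((a⁻¹ * b : C) : G) ∈ C ⊓ (P ⊔ D) := ⟨(a⁻¹ * b).2, by simpa using hab'⟩
    rwa [inf_sup_eq_of_isComplement' P C hPC hDC] at hmem
  · rintro ⟨g⟩
    obtain ⟨⟨q, c⟩, hqc⟩ := hPC.2 g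
    refine ⟨Quotient.mk'' c, ?_⟩
    change (QuotientGroup.mk ((c : C) : G) : G ⧸ (P ⊔ D)) = QuotientGroup.mk g
    rw [QuotientGroup.eq]
    have hg : (q : G) * (c : G) = g := hqc
    rw [← hg, ← mul_assoc]
    have : ((c : C) : G)⁻¹ * (q : G) * (c : C) ∈ P :=
      by simpa [mul_assoc] using (inferInstance : P.Normal).conj_mem' _ q.2 ((c : C) : G)
    exact mem_sup_left this

/-- A complement contained in a complement equals it. [cite: RibesZalesskii2010, Thm 2.3.15] -/
theorem eq_of_le_of_isComplement' (P : Subgroup G) {C C' : Subgroup G} (hPC : IsComplement' P C)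
    (hPC' : IsComplement' P C') (hle : C ≤ C') : C = C' := by
  refine le_antisymm hle fun x hx => ?_
  obtain ⟨⟨q, c⟩, hqc⟩ := hPC.2 x
  have hx' : (q : G) * (c : G) = x := hqc
  have hqC' : (q : G) ∈ C' := by
    have := mul_mem hx (inv_mem (hle c.2))
    rwa [← hx', mul_inv_cancel_right] at this
  have hq1 : (q : G) = 1 := by
    have hdis := hPC'.disjoint
    rw [disjoint_iff] at hdis
    have : (q : G) ∈ P ⊓ C' := ⟨q.2, hqC'⟩
    rw [hdis] at this
    exact this
  rw [← hx', hq1, one_mul]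
  exact c.2

/-- A normal subgroup is fixed by conjugation (auxiliary). [folklore] -/
private theorem map_conj_eq_self (P : Subgroup G) [hPn : P.Normal] (x : G) :
    P.map (MulAut.conj x).toMonoidHom = P := by
  ext y
  constructor
  · rintro ⟨z, hz, rfl⟩
    exact hPn.conj_mem z hz x
  · intro hy
    refine ⟨x⁻¹ * y * x⁻¹⁻¹, hPn.conj_mem y hy x⁻¹, ?_⟩
    simp [MulAut.conj_apply, mul_assoc]

/-- Conjugating a complement of a normal subgroup gives a complement. [folklore] -/
private theorem isComplement'_map_conj (P : Subgroup G) [hPn : P.Normal] {C : Subgroup G}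
    (hPC : IsComplement' P C) (x : G) : IsComplement' P (C.map (MulAut.conj x).toMonoidHom) := by
  have hP : P.map (MulAut.conj x).toMonoidHom = P := map_conj_eq_self P x
  have hinj : Function.Injective (MulAut.conj x).toMonoidHom := fun a b h => (MulAut.conj x).injective h
  have hsurj : Function.Surjective (MulAut.conj x).toMonoidHom := fun b => (MulAut.conj x).surjective b
  have hdis : Disjoint P (C.map (MulAut.conj x).toMonoidHom) := by
    rw [disjoint_iff]
    conv_lhs => rw [← hP]
    rw [← Subgroup.map_inf_eq _ _ _ hinj, disjoint_iff.mp hPC.disjoint, Subgroup.map_bot]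
  have hsup : P ⊔ C.map (MulAut.conj x).toMonoidHom = ⊤ := by
    conv_lhs => rw [← hP]
    rw [← Subgroup.map_sup, hPC.sup_eq_top]
    exact Subgroup.map_top_of_surjective _ hsurj
  refine isComplement'_of_disjoint_and_mul_eq_univ hdis ?_
  rw [← Subgroup.normal_mul, hsup, Subgroup.coe_top]

end Algebra

/-! ### Closed complements are complements levelwise -/

section Profinite

universe u

variable {G : Type u} [Group G] [TopologicalSpace G] [IsTopologicalGroup G] [CompactSpace G]
  [TotallyDisconnectedSpace G]

omit [IsTopologicalGroup G] [CompactSpace G] [TotallyDisconnectedSpace G] in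
/-- The index of the image of `P` in `G ⧸ V` is `[G : P V]`. [folklore] -/
private theorem index_map_mk' (P : Subgroup G) (V : OpenNormalSubgroup G) :
    (P.map (QuotientGroup.mk' (V : Subgroup G))).index = (P ⊔ (V : Subgroup G)).index := by
  rw [Subgroup.index_map, QuotientGroup.ker_mk',
    MonoidHom.range_eq_top.mpr (QuotientGroup.mk'_surjective _), Subgroup.index_top, mul_one]

/-- **A closed complement is a complement levelwise.** Let `G` be profinite, `P ⊴ G` closed with
`P̄_V := im(P → G ⧸ V)` a `p`-group of index prime to `p` for every open normal `V`, and `C` a closed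
complement of `P`. Then `C̄_V` is a complement of `P̄_V` in `G ⧸ V` for every `V`: `|C̄_V| = [C : C ∩ V] =
[G : P(C ∩ V)]` (index transfer) is the index of an open subgroup containing `P`, hence divides some
`[G : P V″]`, which is prime to `p`. [cite: RibesZalesskii2010, Thm 2.3.15] -/
theorem isComplement'_map_mk'_of_isComplement' {p : ℕ} [Fact p.Prime] (P : Subgroup G) [P.Normal]
    (hPc : IsClosed (P : Set G))
    (hP : ∀ V : OpenNormalSubgroup G, IsPGroup p (P.map (QuotientGroup.mk' (V : Subgroup G))))
    (hQ : ∀ V : OpenNormalSubgroup G,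
      Nat.Coprime p (P.map (QuotientGroup.mk' (V : Subgroup G))).index)
    {C : Subgroup G} (hCc : IsClosed (C : Set G)) (hPC : IsComplement' P C)
    (V : OpenNormalSubgroup G) :
    IsComplement' (P.map (QuotientGroup.mk' (V : Subgroup G)))
      (C.map (QuotientGroup.mk' (V : Subgroup G))) := by
  classical
  haveI : Finite (G ⧸ (V : Subgroup G)) := inferInstance
  haveI hPn : (P.map (QuotientGroup.mk' (V : Subgroup G))).Normal :=
    Subgroup.Normal.map inferInstance _ (QuotientGroup.mk'_surjective _)
  -- `D = C ∩ V`, `U = P D`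
  set D : Subgroup G := C ⊓ (V : Subgroup G) with hD
  set U : Subgroup G := P ⊔ D with hU
  have hidx : D.relIndex C = U.index := relIndex_eq_index_sup_of_isComplement' P C hPC inf_le_left
  -- `|C̄_V| = [C : C ∩ V] = [G : U]`
  have hcardC : Nat.card (C.map (QuotientGroup.mk' (V : Subgroup G))) = U.index := by
    rw [← Subgroup.relIndex_ker, QuotientGroup.ker_mk', ← Subgroup.inf_relIndex_left, hidx]
  -- `U` has finite index and is closed, hence open, hence contains some open normal `V″`
  have hUne : U.index ≠ 0 := by
    rw [← hidx, hD, Subgroup.inf_relIndex_left]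
    intro h0
    have hdvd := Subgroup.relIndex_dvd_index_of_normal (V : Subgroup G) C
    rw [h0, zero_dvd_iff] at hdvd
    exact Subgroup.index_ne_zero_of_finite hdvd
  haveI : U.FiniteIndex := ⟨hUne⟩
  have hDc : IsClosed (D : Set G) := by
    rw [hD, Subgroup.coe_inf]
    exact hCc.inter V.toOpenSubgroup.isClosed
  have hUc : IsClosed (U : Set G) := by
    rw [hU, Subgroup.normal_mul]
    exact (hPc.isCompact.mul hDc.isCompact).isClosed
  have hUo : IsOpen (U : Set G) := Subgroup.isOpen_of_isClosed_of_finiteIndex U hUc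
  obtain ⟨V'', hV''⟩ := ProfiniteGrp.exist_openNormalSubgroup_sub_open_nhds_of_one hUo (one_mem U)
  have hle : P ⊔ (V'' : Subgroup G) ≤ U := sup_le le_sup_left fun x hx => hV'' hx
  have hcop : Nat.Coprime p U.index := by
    refine (hQ V'').coprime_dvd_right ?_
    rw [index_map_mk']
    exact Subgroup.index_dvd_of_le hle
  -- coprime orders, hence disjoint images; and the images generate everything
  obtain ⟨n, hn⟩ := (hP V).exists_card_eq
  have hdis : Disjoint (P.map (QuotientGroup.mk' (V : Subgroup G)))
      (C.map (QuotientGroup.mk' (V : Subgroup G))) := by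
    refine Subgroup.disjoint_of_coprime_natCard ?_
    rw [hn, hcardC]
    exact Nat.Coprime.pow_left n hcop
  have hsup : P.map (QuotientGroup.mk' (V : Subgroup G)) ⊔ C.map (QuotientGroup.mk' (V : Subgroup G))
      = ⊤ := by
    rw [← Subgroup.map_sup, hPC.sup_eq_top]
    exact Subgroup.map_top_of_surjective _ (QuotientGroup.mk'_surjective _)
  refine isComplement'_of_disjoint_and_mul_eq_univ hdis ?_
  rw [← Subgroup.normal_mul, hsup, Subgroup.coe_top]

/-! ### Conjugacy of closed complements -/

/-- In a profinite group, an element lying in `C′ V` for every open normal `V` lies in the closed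
subgroup `C′`. [folklore] -/
private theorem mem_of_forall_mem_sup [T2Space G] {C' : Subgroup G} (hC'c : IsClosed (C' : Set G))
    {y : G} (hy : ∀ V : OpenNormalSubgroup G, y ∈ C' ⊔ (V : Subgroup G)) : y ∈ C' := by
  by_contra hyC
  -- an open normal `W` with `y W ∩ C' = ∅`
  have hO : IsOpen {w : G | y * w ∈ (C' : Set G)ᶜ} :=
    hC'c.isOpen_compl.preimage (continuous_const.mul continuous_id)
  obtain ⟨W, hW⟩ := ProfiniteGrp.exist_openNormalSubgroup_sub_open_nhds_of_one hO (by simpa using hyC)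
  have hyW : y ∈ ((C' ⊔ (W : Subgroup G) : Subgroup G) : Set G) := hy W
  rw [Subgroup.mul_normal] at hyW
  obtain ⟨c, hc, w, hw, hcw⟩ := Set.mem_mul.mp hyW
  have hw' : w⁻¹ ∈ (W : Subgroup G) := inv_mem hw
  have := hW hw'
  simp only [Set.mem_setOf_eq, Set.mem_compl_iff, SetLike.mem_coe] at this
  apply this
  rw [← hcw, mul_inv_cancel_right]
  exact hc

end Profinite

/-! ### The conjugacy theorem

Stated for `G : Type` (universe `0`), the universe of the tree's finite conjugacy theorem
`Literature.GroupTheory.Solvable.exists_conj_eq_of_isComplement'_of_isSolvable`. -/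

section Conjugacy

variable {G : Type} [Group G] [TopologicalSpace G] [IsTopologicalGroup G] [CompactSpace G]
  [TotallyDisconnectedSpace G]

/-- **Profinite Schur–Zassenhaus theorem (conjugacy of closed complements, `p`-primary case).** Let
`G` be a profinite group and `P ⊴ G` a closed normal subgroup such that in every finite continuous
quotient `G ⧸ V` the image of `P` is a `p`-group of index prime to `p` (`P` pro-`p`, `G ⧸ P`
pro-`p′`). Then any two CLOSED complements `C, C′` of `P` are conjugate: `C′ = x C x⁻¹` for some
`x ∈ G`. (Levelwise conjugacy by the finite Schur–Zassenhaus theorem, then compactness.)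
[cite: RibesZalesskii2010, Thm 2.3.15] -/
theorem exists_conj_eq_of_closed_isComplement' [T2Space G] {p : ℕ} [Fact p.Prime] (P : Subgroup G)
    [P.Normal] (hPc : IsClosed (P : Set G))
    (hP : ∀ V : OpenNormalSubgroup G, IsPGroup p (P.map (QuotientGroup.mk' (V : Subgroup G))))
    (hQ : ∀ V : OpenNormalSubgroup G,
      Nat.Coprime p (P.map (QuotientGroup.mk' (V : Subgroup G))).index)
    {C C' : Subgroup G} (hCc : IsClosed (C : Set G)) (hC'c : IsClosed (C' : Set G))
    (hPC : IsComplement' P C) (hPC' : IsComplement' P C') :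
    ∃ x : G, C' = C.map (MulAut.conj x).toMonoidHom := by
  classical
  haveI : Nonempty (OpenNormalSubgroup G) :=
    ⟨{ toOpenSubgroup := ⊤, isNormal' := by change (⊤ : Subgroup G).Normal; infer_instance }⟩
  -- the closed, nonempty, directed sets `T V = {x | x C x⁻¹ ⊆ C' V}`
  let T : OpenNormalSubgroup G → Set G :=
    fun V => {x : G | ∀ c ∈ C, x * c * x⁻¹ ∈ C' ⊔ (V : Subgroup G)}
  have hTc : ∀ V, IsClosed (T V) := by
    intro V
    have hopen : IsOpen (((C' ⊔ (V : Subgroup G) : Subgroup G)) : Set G) :=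
      Subgroup.isOpen_mono le_sup_right V.toOpenSubgroup.isOpen
    have hclosed : IsClosed (((C' ⊔ (V : Subgroup G) : Subgroup G)) : Set G) :=
      OpenSubgroup.isClosed ⟨_, hopen⟩
    have : T V = ⋂ c ∈ C, (fun x : G => x * c * x⁻¹) ⁻¹' ((C' ⊔ (V : Subgroup G) : Subgroup G) : Set G) := by
      ext x; simp [T]
    rw [this]
    exact isClosed_biInter fun c _ => hclosed.preimage (by fun_prop)
  have hTne : ∀ V, (T V).Nonempty := by
    intro V
    haveI : Finite (G ⧸ (V : Subgroup G)) := inferInstance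
    set K := P.map (QuotientGroup.mk' (V : Subgroup G)) with hK
    haveI hKn : K.Normal := Subgroup.Normal.map inferInstance _ (QuotientGroup.mk'_surjective _)
    haveI : Group.IsNilpotent K := IsPGroup.isNilpotent (hP V)
    have hKcop : (Nat.card K).Coprime K.index := by
      obtain ⟨n, hn⟩ := (hP V).exists_card_eq
      rw [hn]
      exact Nat.Coprime.pow_left n (hQ V)
    have h₁ := (isComplement'_map_mk'_of_isComplement' P hPc hP hQ hCc hPC V).symm
    have h₂ := (isComplement'_map_mk'_of_isComplement' P hPc hP hQ hC'c hPC' V).symm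
    obtain ⟨g, hg⟩ := Solvable.exists_conj_eq_of_isComplement'_of_isSolvable K hKcop h₁ h₂
    obtain ⟨x, rfl⟩ := QuotientGroup.mk'_surjective (V : Subgroup G) g
    refine ⟨x, fun c hc => ?_⟩
    -- `mk (x c x⁻¹) = ḡ c̄ ḡ⁻¹ ∈ C̄'`, so `x c x⁻¹ ∈ C' V`
    have hmem : QuotientGroup.mk' (V : Subgroup G) (x * c * x⁻¹) ∈
        C'.map (QuotientGroup.mk' (V : Subgroup G)) := by
      rw [hg, map_mul, map_mul, map_inv]
      exact Subgroup.mem_map_of_mem (MulAut.conj (QuotientGroup.mk' (V : Subgroup G) x)).toMonoidHom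
        (Subgroup.mem_map_of_mem _ hc)
    have := Subgroup.mem_comap.mpr hmem
    rw [Subgroup.comap_map_eq, QuotientGroup.ker_mk'] at this
    exact this
  have hTdir : Directed (· ⊇ ·) T := by
    intro V₁ V₂
    refine ⟨V₁ ⊓ V₂, fun x hx c hc => ?_, fun x hx c hc => ?_⟩
    · exact (sup_le_sup_left (show ((V₁ ⊓ V₂ : OpenNormalSubgroup G) : Subgroup G) ≤ (V₁ : Subgroup G)
        from fun y hy => (inf_le_left : V₁ ⊓ V₂ ≤ V₁) hy) C') (hx c hc)
    · exact (sup_le_sup_left (show ((V₁ ⊓ V₂ : OpenNormalSubgroup G) : Subgroup G) ≤ (V₂ : Subgroup G)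
        from fun y hy => (inf_le_right : V₁ ⊓ V₂ ≤ V₂) hy) C') (hx c hc)
  obtain ⟨x, hx⟩ := IsCompact.nonempty_iInter_of_directed_nonempty_isCompact_isClosed T hTdir hTne
    (fun V => (hTc V).isCompact) hTc
  rw [Set.mem_iInter] at hx
  -- `x C x⁻¹ ≤ C'`, hence equality
  refine ⟨x, (eq_of_le_of_isComplement' P (isComplement'_map_conj P hPC x) hPC' ?_).symm⟩
  rintro _ ⟨c, hc, rfl⟩
  exact mem_of_forall_mem_sup hC'c fun V => by simpa using hx V c hc

end Conjugacy

end Literature.GroupTheory
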